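import Summits.Ventures.LatticeQCDFlow.Exactness.IMHAcceptanceWeightOrder
import Summits.Ventures.LatticeQCDFlow.Exactness.StdGaussianWedgeProbabilities
import HarnessLib

/-!
# The exact free-field check of the flow arm's acceptance column: a Gaussian flow `N(0,t)` on a
# Gaussian mode `N(0,s)` is accepted with probability EXACTLY `ā = (4/π)·arctan r`,
# `r = min(σ_q/σ_π, σ_π/σ_q)` — equivalently `1 − (2/π)·arctan √(J/2)`, `J` the Jeffreys divergence

HONEST FRAMING: exact (Metropolis-corrected) sampling algorithms for lattice gauge theory;
figures of merit are autocorrelation/cost numbers at stated couplings and volumes; no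
continuum-physics claim.  (SCALAR calibration rung S0-A: not a gauge result.)

Venture `LatticeQCDFlow` (cell pub-lqcd), topic `Exactness`; FANOUT row 2 (`s0-phi4`, FLOW arm; the
row's battery item "exact free-field limit check").  NEW WORK of the cell, composing this session's
`IMHAcceptanceWeightOrder` (`ā·Z = P(b(X) ≤ b(Y)) + P(b(X) < b(Y))`, `X ∼ target`, `Y ∼ model`)
with row 13's two-Gaussian cone probability `GeneralNCMC.gaussianReal_prod_measure_abs_le_mul_abs`
(`(N(0,1) ⊗ N(0,1)){|x| ≤ q|y|} = (2/π)·arctan q`, polar coordinates) and Mathlib's Gaussian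
push-forwards.  Nothing is cited as a fact; no definition.  No printed counterpart is claimed: the
closed form is elementary, and serves here as a CERTIFIED TEST VALUE for the calibration engine's
acceptance column (flow arm at `λ = 0` with a diagonal Gaussian flow, one mode at a time).

ROUTE.  `b = p_s/p_t ∝ exp(x²(1/(2t) − 1/(2s)))`: for a narrow model (`t < s`) `{b(X) ≤ b(Y)} =
{|X| ≤ |Y|}`, a cone of the standardised pair of mass `(2/π)·arctan(√t/√s)`; the strict event has the same
mass (`arctan(1/r) = π/2 − arctan r`); a wide model is the mirror image, the perfect model accepts always.

## What is proved (`s t : ℝ≥0`, both `≠ 0`; densities `gaussianPDFReal 0 s`, `gaussianPDFReal 0 t`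
as target weight and model, Lebesgue reference measure, `imhAcceptQ` of `FlowSamplerOperator`)

* §1 `gaussianMode_weight_eq`, `gaussianMode_weight_le_iff_of_lt` / `…lt_iff_of_lt` (`t < s`:
  `b(x) ≤ b(y) ↔ |x| ≤ |y|`), `…_of_gt` (`s < t`: `↔ |y| ≤ |x|`);
* §2 (with this session's `StdGaussianWedgeProbabilities` for the product-Gaussian bookkeeping)
  **`gaussianProd_measure_abs_fst_le_abs_snd`**
  (`(N(0,s) ⊗ N(0,t)){|x| ≤ |y|} = (2/π)·arctan(√t/√s)`), `gaussianProd_measure_abs_snd_le_abs_fst`,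
  `gaussianProd_real_abs_fst_lt_abs_snd`;
* §3 **`gaussianMode_meanAccept_of_lt`** (`t < s`: `ā = (4/π)·arctan(√t/√s)`),
  **`gaussianMode_meanAccept_of_gt`** (`s < t`: `(4/π)·arctan(√s/√t)`), `gaussianMode_meanAccept_self`
  (`s = t`: `ā = 1`), **`gaussianMode_meanAccept`** (all cases:
  `ā = (4/π)·arctan(√(min(s,t))/√(max(s,t)))`);
* §4 `pi_div_four_mul_le_arctan` (chord; `arctan` is concave on `[0, ∞)` — private, the tree's
  `Literature/…/FKIsingQuadrilateralCrossingProofs` has the same lemma), `arctan_le_tangent_one` (tangent),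
  **`gaussianMode_meanAccept_bounds`** (`r ≤ ā ≤ 1 − (2/π)(1 − r)`);
* §5 **`gaussianMode_meanAccept_eq_universal`** — `ā = 1 − (2/π)·arctan √(J/2)`, `J = (s − t)²/(2st)` the
  Jeffreys divergence of the two Gaussians (= the swap involution's mean violation `⟨ΔH⟩`): the SAME
  curve in the mean violation as the site update (`GaussianMetropolisSiteAcceptance`) and the
  leapfrog trajectory (`FreeFieldHMCModeAcceptance`) on a Gaussian mode.

Reading for S0-A (no numerics implied beyond the displayed constants): a diagonal Gaussian flow whose
width on a free-field mode is off by the factor `r` (either way) is accepted on that mode with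
probability `(4/π)·arctan r` — e.g. `r = 0.9 ↦ 0.9330`, `r = 0.5 ↦ 0.5903`; the law depends on the
ratio only and is symmetric under model ↔ target (as every IMH acceptance is).  NOT CLAIMED: several
modes (no closed-form sign law; the tree's volume sandwiches apply); `τ_int` (`GaussModeTauIntDichotomy`:
`W₂ = ∞` once `t ≤ s/2` although `ā(t = s/2) ≈ 0.78`); the Gaussian evaluation of `J` as the integral
`⟨ΔH⟩` of `FlowSamplerSwapInvolution` (not typed here); any value for a trained network.
-/

namespace Summit.Ventures.LatticeQCDFlow.Exactness

open Real MeasureTheory ProbabilityTheory Filter Set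
open scoped NNReal ENNReal

section GaussianMode

variable {s t : ℝ≥0}

/-! ## §1 The importance weight of a Gaussian flow on a Gaussian mode -/

/-- The weight of the target `N(0,s)` over the model `N(0,t)`:
`b(x) = (√(2πt)/√(2πs)) · exp(x²·(1/(2t) − 1/(2s)))`. -/
theorem gaussianMode_weight_eq (hs : s ≠ 0) (ht : t ≠ 0) (x : ℝ) :
    gaussianPDFReal 0 s x / gaussianPDFReal 0 t x
      = Real.sqrt (2 * π * t) / Real.sqrt (2 * π * s)
        * Real.exp (x ^ 2 * (1 / (2 * t) - 1 / (2 * s))) := by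
  have hs' : (0 : ℝ) < s := by exact_mod_cast pos_iff_ne_zero.mpr hs
  have ht' : (0 : ℝ) < t := by exact_mod_cast pos_iff_ne_zero.mpr ht
  have hS : 0 < Real.sqrt (2 * π * s) := Real.sqrt_pos.mpr (by positivity)
  have hT : 0 < Real.sqrt (2 * π * t) := Real.sqrt_pos.mpr (by positivity)
  simp only [gaussianPDFReal_def, sub_zero]
  rw [show x ^ 2 * (1 / (2 * t) - 1 / (2 * s)) = -x ^ 2 / (2 * s) - (-x ^ 2 / (2 * t)) by
    field_simp; ring, Real.exp_sub]
  field_simp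

/-- **Narrow model (`t < s`): the weight increases with `|x|`** — `b(x) ≤ b(y) ↔ |x| ≤ |y|`. -/
theorem gaussianMode_weight_le_iff_of_lt (hs : s ≠ 0) (ht : t ≠ 0) (hts : (t : ℝ) < s) (x y : ℝ) :
    gaussianPDFReal 0 s x / gaussianPDFReal 0 t x ≤ gaussianPDFReal 0 s y / gaussianPDFReal 0 t y
      ↔ |x| ≤ |y| := by
  have hs' : (0 : ℝ) < s := by exact_mod_cast pos_iff_ne_zero.mpr hs
  have ht' : (0 : ℝ) < t := by exact_mod_cast pos_iff_ne_zero.mpr ht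
  have hC : 0 < Real.sqrt (2 * π * t) / Real.sqrt (2 * π * s) :=
    div_pos (Real.sqrt_pos.mpr (by positivity)) (Real.sqrt_pos.mpr (by positivity))
  have ha : 0 < 1 / (2 * (t : ℝ)) - 1 / (2 * s) := by
    rw [sub_pos, one_div_lt_one_div (by positivity) (by positivity)]; linarith
  rw [gaussianMode_weight_eq hs ht, gaussianMode_weight_eq hs ht, mul_le_mul_iff_right₀ hC,
    Real.exp_le_exp, mul_le_mul_iff_left₀ ha, sq_le_sq]

/-- Narrow model, strict form: `b(x) < b(y) ↔ |x| < |y|`. -/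
theorem gaussianMode_weight_lt_iff_of_lt (hs : s ≠ 0) (ht : t ≠ 0) (hts : (t : ℝ) < s) (x y : ℝ) :
    gaussianPDFReal 0 s x / gaussianPDFReal 0 t x < gaussianPDFReal 0 s y / gaussianPDFReal 0 t y
      ↔ |x| < |y| := by
  rw [← not_le, gaussianMode_weight_le_iff_of_lt hs ht hts, not_le]

/-- **Wide model (`s < t`): the weight decreases with `|x|`** — `b(x) ≤ b(y) ↔ |y| ≤ |x|`. -/
theorem gaussianMode_weight_le_iff_of_gt (hs : s ≠ 0) (ht : t ≠ 0) (hst : (s : ℝ) < t) (x y : ℝ) :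
    gaussianPDFReal 0 s x / gaussianPDFReal 0 t x ≤ gaussianPDFReal 0 s y / gaussianPDFReal 0 t y
      ↔ |y| ≤ |x| := by
  -- `b_{s,t} = 1/b_{t,s}`, and `b_{t,s}` is the narrow-model weight
  rw [← gaussianMode_weight_le_iff_of_lt ht hs hst y x,
    ← one_div_le_one_div (div_pos (gaussianPDFReal_pos 0 s y hs) (gaussianPDFReal_pos 0 t y ht))
      (div_pos (gaussianPDFReal_pos 0 s x hs) (gaussianPDFReal_pos 0 t x ht)), one_div_div, one_div_div]

/-- Wide model, strict form: `b(x) < b(y) ↔ |y| < |x|`. -/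
theorem gaussianMode_weight_lt_iff_of_gt (hs : s ≠ 0) (ht : t ≠ 0) (hst : (s : ℝ) < t) (x y : ℝ) :
    gaussianPDFReal 0 s x / gaussianPDFReal 0 t x < gaussianPDFReal 0 s y / gaussianPDFReal 0 t y
      ↔ |y| < |x| := by
  rw [← not_le, gaussianMode_weight_le_iff_of_gt hs ht hst, not_le]

/-! ## §2 The two Gaussian cone probabilities -/

/-- **The cone probability**: `(N(0,s) ⊗ N(0,t)){|x| ≤ |y|} = (2/π)·arctan(√t/√s)` (`s ≠ 0`). -/
theorem gaussianProd_measure_abs_fst_le_abs_snd (hs : s ≠ 0) (t : ℝ≥0) :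
    ((gaussianReal 0 s).prod (gaussianReal 0 t)) {z : ℝ × ℝ | |z.1| ≤ |z.2|}
      = ENNReal.ofReal (2 / π * Real.arctan (Real.sqrt t / Real.sqrt s)) := by
  have hs' : (0 : ℝ) < s := by exact_mod_cast pos_iff_ne_zero.mpr hs
  have hS : 0 < Real.sqrt (s : ℝ) := Real.sqrt_pos.mpr hs'
  have hmeas : MeasurableSet {z : ℝ × ℝ | |z.1| ≤ |z.2|} :=
    measurableSet_le measurable_fst.abs measurable_snd.abs
  have hf : Measurable fun x : ℝ => Real.sqrt (s : ℝ) * x := measurable_const.mul measurable_id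
  have hg : Measurable fun x : ℝ => Real.sqrt (t : ℝ) * x := measurable_const.mul measurable_id
  rw [stepTarget_prod_eq_map s t, Measure.map_apply (hf.prodMap hg) hmeas]
  have hpre : (Prod.map (fun x : ℝ => Real.sqrt (s : ℝ) * x) (fun x : ℝ => Real.sqrt (t : ℝ) * x))
      ⁻¹' {z : ℝ × ℝ | |z.1| ≤ |z.2|}
      = {z : ℝ × ℝ | |z.1| ≤ Real.sqrt t / Real.sqrt s * |z.2|} := by
    ext z
    simp only [mem_preimage, Prod.map, mem_setOf_eq, abs_mul, abs_of_pos hS,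
      abs_of_nonneg (Real.sqrt_nonneg (t : ℝ))]
    rw [div_mul_eq_mul_div, le_div_iff₀ hS, mul_comm (Real.sqrt s) |z.1|]
  rw [hpre]
  exact GeneralNCMC.gaussianReal_prod_measure_abs_le_mul_abs
    (div_nonneg (Real.sqrt_nonneg _) (Real.sqrt_nonneg _))

/-- The mirror cone: `(N(0,s) ⊗ N(0,t)){|y| ≤ |x|} = (2/π)·arctan(√s/√t)` (`t ≠ 0`). -/
theorem gaussianProd_measure_abs_snd_le_abs_fst (s : ℝ≥0) (ht : t ≠ 0) :
    ((gaussianReal 0 s).prod (gaussianReal 0 t)) {z : ℝ × ℝ | |z.2| ≤ |z.1|}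
      = ENNReal.ofReal (2 / π * Real.arctan (Real.sqrt s / Real.sqrt t)) := by
  rw [← Measure.prod_swap, Measure.map_apply measurable_swap
    (measurableSet_le measurable_snd.abs measurable_fst.abs)]
  have hpre : (Prod.swap : ℝ × ℝ → ℝ × ℝ) ⁻¹' {z : ℝ × ℝ | |z.2| ≤ |z.1|} = {z : ℝ × ℝ | |z.1| ≤ |z.2|} := by
    ext z; simp
  rw [hpre]
  exact gaussianProd_measure_abs_fst_le_abs_snd ht s

/-- The strict cone by complement: `P{|x| < |y|} = 1 − P{|y| ≤ |x|}` (real form). -/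
theorem gaussianProd_real_abs_fst_lt_abs_snd (s t : ℝ≥0) :
    (((gaussianReal 0 s).prod (gaussianReal 0 t)) {z : ℝ × ℝ | |z.1| < |z.2|}).toReal
      = 1 - (((gaussianReal 0 s).prod (gaussianReal 0 t)) {z : ℝ × ℝ | |z.2| ≤ |z.1|}).toReal := by
  have hmeas : MeasurableSet {z : ℝ × ℝ | |z.2| ≤ |z.1|} :=
    measurableSet_le measurable_snd.abs measurable_fst.abs
  have hc : {z : ℝ × ℝ | |z.1| < |z.2|} = {z : ℝ × ℝ | |z.2| ≤ |z.1|}ᶜ := by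
    ext z; simp [not_le]
  rw [hc, ← measureReal_def, ← measureReal_def, probReal_compl_eq_one_sub hmeas]

/-- `(2/π)·arctan` of a nonnegative real is in `[0, 1]`-compatible form: `0 ≤ 2/π · arctan r`. -/
theorem two_div_pi_mul_arctan_nonneg {r : ℝ} (hr : 0 ≤ r) : 0 ≤ 2 / π * Real.arctan r :=
  mul_nonneg (div_nonneg zero_le_two pi_pos.le) (Real.arctan_nonneg.mpr hr)

/-! ## §3 The acceptance law `ā = (4/π)·arctan r` -/

/-- **NARROW MODEL** (`0 < t < s`): the exact flow sampler with model `N(0,t)` on the target mode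
`N(0,s)` accepts, in equilibrium, with probability `(4/π)·arctan(√t/√s)`. -/
theorem gaussianMode_meanAccept_of_lt (hs : s ≠ 0) (ht : t ≠ 0) (hts : (t : ℝ) < s) :
    ∫ x, gaussianPDFReal 0 s x * (∫ y, imhAcceptQ (gaussianPDFReal 0 s) (gaussianPDFReal 0 t) x y
        * gaussianPDFReal 0 t y)
      = 4 / π * Real.arctan (Real.sqrt t / Real.sqrt s) := by
  have hs' : (0 : ℝ) < s := by exact_mod_cast pos_iff_ne_zero.mpr hs
  have ht' : (0 : ℝ) < t := by exact_mod_cast pos_iff_ne_zero.mpr ht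
  have hr : 0 < Real.sqrt t / Real.sqrt s := div_pos (Real.sqrt_pos.mpr ht') (Real.sqrt_pos.mpr hs')
  rw [imh_meanAccept_eq_weightOrder (μ := volume) (fun x => gaussianPDFReal_pos 0 s x hs)
    (measurable_gaussianPDFReal 0 s) (integrable_gaussianPDFReal 0 s)
    (fun x => gaussianPDFReal_pos 0 t x ht) (measurable_gaussianPDFReal 0 t) (integrable_gaussianPDFReal 0 t)]
  simp only [gaussianMode_weight_le_iff_of_lt hs ht hts, gaussianMode_weight_lt_iff_of_lt hs ht hts]
  rw [show (fun z : ℝ × ℝ => (if |z.1| ≤ |z.2| then (1 : ℝ) else 0)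
        * (gaussianPDFReal 0 s z.1 * gaussianPDFReal 0 t z.2))
      = fun z => (if z ∈ {z : ℝ × ℝ | |z.1| ≤ |z.2|} then (1 : ℝ) else 0)
        * (gaussianPDFReal 0 s z.1 * gaussianPDFReal 0 t z.2) from rfl,
    show (fun z : ℝ × ℝ => (if |z.1| < |z.2| then (1 : ℝ) else 0)
        * (gaussianPDFReal 0 s z.1 * gaussianPDFReal 0 t z.2))
      = fun z => (if z ∈ {z : ℝ × ℝ | |z.1| < |z.2|} then (1 : ℝ) else 0)
        * (gaussianPDFReal 0 s z.1 * gaussianPDFReal 0 t z.2) from rfl,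
    integral_ite_mul_stepTarget_prod hs ht (measurableSet_le measurable_fst.abs measurable_snd.abs),
    integral_ite_mul_stepTarget_prod hs ht (measurableSet_lt measurable_fst.abs measurable_snd.abs),
    gaussianProd_real_abs_fst_lt_abs_snd, gaussianProd_measure_abs_fst_le_abs_snd hs t,
    gaussianProd_measure_abs_snd_le_abs_fst s ht,
    ENNReal.toReal_ofReal (two_div_pi_mul_arctan_nonneg hr.le),
    ENNReal.toReal_ofReal (two_div_pi_mul_arctan_nonneg
      (div_nonneg (Real.sqrt_nonneg _) (Real.sqrt_nonneg _))),
    show Real.sqrt (s : ℝ) / Real.sqrt t = (Real.sqrt t / Real.sqrt s)⁻¹ by rw [inv_div],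
    Real.arctan_inv_of_pos hr]
  field_simp
  ring

/-- **WIDE MODEL** (`0 < s < t`): acceptance `(4/π)·arctan(√s/√t)`. -/
theorem gaussianMode_meanAccept_of_gt (hs : s ≠ 0) (ht : t ≠ 0) (hst : (s : ℝ) < t) :
    ∫ x, gaussianPDFReal 0 s x * (∫ y, imhAcceptQ (gaussianPDFReal 0 s) (gaussianPDFReal 0 t) x y
        * gaussianPDFReal 0 t y)
      = 4 / π * Real.arctan (Real.sqrt s / Real.sqrt t) := by
  have hs' : (0 : ℝ) < s := by exact_mod_cast pos_iff_ne_zero.mpr hs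
  have ht' : (0 : ℝ) < t := by exact_mod_cast pos_iff_ne_zero.mpr ht
  have hr : 0 < Real.sqrt s / Real.sqrt t := div_pos (Real.sqrt_pos.mpr hs') (Real.sqrt_pos.mpr ht')
  rw [imh_meanAccept_eq_weightOrder (μ := volume) (fun x => gaussianPDFReal_pos 0 s x hs)
    (measurable_gaussianPDFReal 0 s) (integrable_gaussianPDFReal 0 s)
    (fun x => gaussianPDFReal_pos 0 t x ht) (measurable_gaussianPDFReal 0 t) (integrable_gaussianPDFReal 0 t)]
  simp only [gaussianMode_weight_le_iff_of_gt hs ht hst, gaussianMode_weight_lt_iff_of_gt hs ht hst]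
  have hc : (fun z : ℝ × ℝ => (if |z.2| < |z.1| then (1 : ℝ) else 0)
        * (gaussianPDFReal 0 s z.1 * gaussianPDFReal 0 t z.2))
      = fun z => (if z ∈ {z : ℝ × ℝ | |z.1| ≤ |z.2|}ᶜ then (1 : ℝ) else 0)
        * (gaussianPDFReal 0 s z.1 * gaussianPDFReal 0 t z.2) := by
    funext z; simp [not_le]
  rw [show (fun z : ℝ × ℝ => (if |z.2| ≤ |z.1| then (1 : ℝ) else 0)
        * (gaussianPDFReal 0 s z.1 * gaussianPDFReal 0 t z.2))
      = fun z => (if z ∈ {z : ℝ × ℝ | |z.2| ≤ |z.1|} then (1 : ℝ) else 0)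
        * (gaussianPDFReal 0 s z.1 * gaussianPDFReal 0 t z.2) from rfl, hc,
    integral_ite_mul_stepTarget_prod hs ht (measurableSet_le measurable_snd.abs measurable_fst.abs),
    integral_ite_mul_stepTarget_prod hs ht
      (measurableSet_le measurable_fst.abs measurable_snd.abs).compl,
    ← measureReal_def, ← measureReal_def,
    probReal_compl_eq_one_sub (measurableSet_le measurable_fst.abs measurable_snd.abs),
    measureReal_def, measureReal_def,
    gaussianProd_measure_abs_snd_le_abs_fst s ht, gaussianProd_measure_abs_fst_le_abs_snd hs t,
    ENNReal.toReal_ofReal (two_div_pi_mul_arctan_nonneg hr.le),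
    ENNReal.toReal_ofReal (two_div_pi_mul_arctan_nonneg
      (div_nonneg (Real.sqrt_nonneg _) (Real.sqrt_nonneg _))),
    show Real.sqrt (t : ℝ) / Real.sqrt s = (Real.sqrt s / Real.sqrt t)⁻¹ by rw [inv_div],
    Real.arctan_inv_of_pos hr]
  field_simp
  ring

/-- **PERFECT MODEL** (`s = t`): acceptance `1` (`= (4/π)·arctan 1`). -/
theorem gaussianMode_meanAccept_self (hs : s ≠ 0) :
    ∫ x, gaussianPDFReal 0 s x * (∫ y, imhAcceptQ (gaussianPDFReal 0 s) (gaussianPDFReal 0 s) x y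
        * gaussianPDFReal 0 s y) = 1 := by
  have hα : ∀ x y, imhAcceptQ (gaussianPDFReal 0 s) (gaussianPDFReal 0 s) x y = 1 := by
    intro x y
    unfold imhAcceptQ
    rw [mul_comm, div_self (mul_ne_zero (gaussianPDFReal_pos 0 s _ hs).ne'
      (gaussianPDFReal_pos 0 s _ hs).ne'), min_self]
  simp_rw [hα, one_mul, integral_gaussianPDFReal_eq_one 0 hs, mul_one, integral_gaussianPDFReal_eq_one 0 hs]

/-- **THE ACCEPTANCE LAW OF A GAUSSIAN FLOW ON A GAUSSIAN MODE**: for every target variance `s > 0`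
and model variance `t > 0`, the exact flow sampler's equilibrium acceptance is
`ā = (4/π)·arctan r`, `r = √(min(s,t)/max(s,t)) = min(σ_q/σ_π, σ_π/σ_q)` — a function of the
width RATIO only, symmetric under `s ↔ t`. -/
theorem gaussianMode_meanAccept (hs : s ≠ 0) (ht : t ≠ 0) :
    ∫ x, gaussianPDFReal 0 s x * (∫ y, imhAcceptQ (gaussianPDFReal 0 s) (gaussianPDFReal 0 t) x y
        * gaussianPDFReal 0 t y)
      = 4 / π * Real.arctan (Real.sqrt (min (s : ℝ) t) / Real.sqrt (max (s : ℝ) t)) := by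
  rcases lt_trichotomy (t : ℝ) s with h | h | h
  · rw [gaussianMode_meanAccept_of_lt hs ht h, min_eq_right h.le, max_eq_left h.le]
  · have hst : s = t := NNReal.coe_injective h.symm
    subst hst
    rw [gaussianMode_meanAccept_self hs, min_self, max_self,
      div_self (Real.sqrt_pos.mpr (by exact_mod_cast pos_iff_ne_zero.mpr hs)).ne', Real.arctan_one]
    field_simp
  · rw [gaussianMode_meanAccept_of_gt hs ht h, min_eq_left h.le, max_eq_right h.le]

/-! ## §4 The law is pinched between the width ratio and its `2/π`-correction -/

/-- `arctan` is concave on `[0, ∞)` (its derivative `1/(1+x²)` is non-increasing there). -/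
private theorem arctan_concaveOn_Ici : ConcaveOn ℝ (Ici (0 : ℝ)) Real.arctan := by
  refine AntitoneOn.concaveOn_of_deriv (convex_Ici 0) Real.continuous_arctan.continuousOn
    (Real.differentiable_arctan.differentiableOn) ?_
  rw [interior_Ici, Real.deriv_arctan]
  intro x hx y _ hxy
  have hx0 : 0 < x := hx
  show 1 / (1 + y ^ 2) ≤ 1 / (1 + x ^ 2)
  exact one_div_le_one_div_of_le (by positivity) (by nlinarith)

/-- **Chord**: `(π/4)·r ≤ arctan r` on `[0, 1]`. -/
theorem pi_div_four_mul_le_arctan {r : ℝ} (h0 : 0 ≤ r) (h1 : r ≤ 1) :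
    π / 4 * r ≤ Real.arctan r := by
  have h := arctan_concaveOn_Ici.2 (self_mem_Ici : (0 : ℝ) ∈ Ici 0) (show (1 : ℝ) ∈ Ici 0 by simp)
    (by linarith : 0 ≤ 1 - r) h0 (by ring : 1 - r + r = 1)
  simp only [smul_eq_mul, mul_zero, mul_one, Real.arctan_zero, zero_add, Real.arctan_one] at h
  linarith

/-- **Tangent at `1`**: `arctan r ≤ π/4 + (r − 1)/2` on `[0, 1]`. -/
theorem arctan_le_tangent_one {r : ℝ} (h0 : 0 ≤ r) (h1 : r ≤ 1) :
    Real.arctan r ≤ π / 4 + (r - 1) / 2 := by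
  have hderiv : ∀ x, HasDerivAt (fun r => π / 4 + (r - 1) / 2 - Real.arctan r)
      (1 / 2 - 1 / (1 + x ^ 2)) x := by
    intro x
    have h1 : HasDerivAt (fun r : ℝ => π / 4 + (r - 1) / 2) (1 / 2) x := by
      have := ((hasDerivAt_id x).sub_const 1).div_const 2
      simpa using this.const_add (π / 4)
    exact h1.sub (Real.hasDerivAt_arctan x)
  have hanti : AntitoneOn (fun r => π / 4 + (r - 1) / 2 - Real.arctan r) (Icc 0 1) := by
    refine antitoneOn_of_deriv_nonpos (convex_Icc 0 1)
      (fun x _ => (hderiv x).continuousAt.continuousWithinAt)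
      (fun x _ => (hderiv x).differentiableAt.differentiableWithinAt) ?_
    rw [interior_Icc]
    intro x hx
    rw [(hderiv x).deriv]
    have : 1 + x ^ 2 ≤ 2 := by nlinarith [hx.1, hx.2]
    have h2 : 1 / (2 : ℝ) ≤ 1 / (1 + x ^ 2) := one_div_le_one_div_of_le (by positivity) this
    linarith
  have h := hanti ⟨h0, h1⟩ ⟨zero_le_one, le_rfl⟩ h1
  simp only [sub_self, zero_div, add_zero, Real.arctan_one] at h
  linarith

/-- **`r ≤ ā ≤ 1 − (2/π)(1 − r)`**: on one Gaussian mode the exact flow sampler's rejection rate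
`1 − ā` is the width mismatch `1 − r` up to the factor `2/π`:  `(2/π)(1 − r) ≤ 1 − ā ≤ 1 − r`,
`r = √(min(s,t)/max(s,t))`. -/
theorem gaussianMode_meanAccept_bounds (hs : s ≠ 0) (ht : t ≠ 0) :
    Real.sqrt (min (s : ℝ) t) / Real.sqrt (max (s : ℝ) t)
        ≤ ∫ x, gaussianPDFReal 0 s x * (∫ y, imhAcceptQ (gaussianPDFReal 0 s) (gaussianPDFReal 0 t) x y
          * gaussianPDFReal 0 t y)
    ∧ ∫ x, gaussianPDFReal 0 s x * (∫ y, imhAcceptQ (gaussianPDFReal 0 s) (gaussianPDFReal 0 t) x y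
          * gaussianPDFReal 0 t y)
        ≤ 1 - 2 / π * (1 - Real.sqrt (min (s : ℝ) t) / Real.sqrt (max (s : ℝ) t)) := by
  have hs' : (0 : ℝ) < s := by exact_mod_cast pos_iff_ne_zero.mpr hs
  have ht' : (0 : ℝ) < t := by exact_mod_cast pos_iff_ne_zero.mpr ht
  set r : ℝ := Real.sqrt (min (s : ℝ) t) / Real.sqrt (max (s : ℝ) t) with hr
  have hmax : 0 < Real.sqrt (max (s : ℝ) t) := Real.sqrt_pos.mpr (lt_max_of_lt_left hs')
  have hr0 : 0 ≤ r := div_nonneg (Real.sqrt_nonneg _) hmax.le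
  have hr1 : r ≤ 1 := by
    rw [hr, div_le_one hmax]
    exact Real.sqrt_le_sqrt (min_le_max)
  rw [gaussianMode_meanAccept hs ht]
  have hlo := pi_div_four_mul_le_arctan hr0 hr1
  have hhi := arctan_le_tangent_one hr0 hr1
  constructor
  · have := mul_le_mul_of_nonneg_left hlo (by positivity : (0 : ℝ) ≤ 4 / π)
    calc r = 4 / π * (π / 4 * r) := by field_simp
      _ ≤ 4 / π * Real.arctan r := this
  · have := mul_le_mul_of_nonneg_left hhi (by positivity : (0 : ℝ) ≤ 4 / π)
    calc 4 / π * Real.arctan r ≤ 4 / π * (π / 4 + (r - 1) / 2) := this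
      _ = 1 - 2 / π * (1 - r) := by field_simp; ring

/-! ## §5 The universal curve: `ā = 1 − (2/π)·arctan √(J/2)`, `J` the Jeffreys divergence -/

/-- `2·arctan r = π/2 − arctan((1 − r²)/(2r))` for `0 < r < 1` (double angle and `arctan x + arctan x⁻¹ = π/2`). -/
private theorem four_div_pi_arctan_eq {r : ℝ} (h0 : 0 < r) (h1 : r < 1) :
    4 / π * Real.arctan r = 1 - 2 / π * Real.arctan ((1 - r ^ 2) / (2 * r)) := by
  have hr2 : 0 < 1 - r ^ 2 := by nlinarith
  have hadd := Real.arctan_add (x := r) (y := r) (by nlinarith)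
  have hx : 0 < 2 * r / (1 - r ^ 2) := by positivity
  rw [show (1 - r ^ 2) / (2 * r) = (2 * r / (1 - r ^ 2))⁻¹ by rw [inv_div], Real.arctan_inv_of_pos hx,
    show 2 * r / (1 - r ^ 2) = (r + r) / (1 - r * r) by ring, ← hadd]
  field_simp
  ring

/-- `(1 − (√t/√s)²)/(2·√t/√s) = (s − t)/(2√(st))` for `0 < t`, `0 < s`. -/
private theorem gaussMode_sqrtRatio_identity {s t : ℝ} (hs : 0 < s) (ht : 0 < t) :
    (1 - (Real.sqrt t / Real.sqrt s) ^ 2) / (2 * (Real.sqrt t / Real.sqrt s)) = (s - t) / (2 * Real.sqrt (s * t)) := by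
  have hS : Real.sqrt s ^ 2 = s := Real.sq_sqrt hs.le
  have hT : Real.sqrt t ^ 2 = t := Real.sq_sqrt ht.le
  have hS0 : 0 < Real.sqrt s := Real.sqrt_pos.mpr hs
  have hT0 : 0 < Real.sqrt t := Real.sqrt_pos.mpr ht
  rw [Real.sqrt_mul hs.le, div_pow, hS, hT]
  field_simp
  nlinarith [hS, hT]

/-- **THE UNIVERSAL CURVE.**  With `J = (s − t)²/(2st)` — the Jeffreys divergence
`D(N(0,s)‖N(0,t)) + D(N(0,t)‖N(0,s))`, i.e. the mean energy violation `⟨ΔH⟩` of the swap involution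
(`FlowSamplerSwapInvolution.integral_deltaH_swapEnergy`; the Gaussian evaluation of those two integrals is
not typed here) — the law of §3 reads `ā = 1 − (2/π)·arctan √(J/2)`: THE SAME FUNCTION of the mean
violation as the Gaussian-step site update (`GaussianMetropolisSiteAcceptance`, `⟨ΔS⟩ = v/(2a)`) and the
free-field leapfrog trajectory (`FreeFieldHMCModeAcceptance`, `⟨ΔH⟩` of `FreeFieldLeapfrogEquilibriumEnergy`). -/
theorem gaussianMode_meanAccept_eq_universal (hs : s ≠ 0) (ht : t ≠ 0) :
    ∫ x, gaussianPDFReal 0 s x * (∫ y, imhAcceptQ (gaussianPDFReal 0 s) (gaussianPDFReal 0 t) x y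
        * gaussianPDFReal 0 t y)
      = 1 - 2 / π * Real.arctan (Real.sqrt ((((s : ℝ) - t) ^ 2 / (2 * (s * t))) / 2)) := by
  have hs' : (0 : ℝ) < s := by exact_mod_cast pos_iff_ne_zero.mpr hs
  have ht' : (0 : ℝ) < t := by exact_mod_cast pos_iff_ne_zero.mpr ht
  have hroot : Real.sqrt ((((s : ℝ) - t) ^ 2 / (2 * (s * t))) / 2) = |(s : ℝ) - t| / (2 * Real.sqrt (s * t)) := by
    rw [show (((s : ℝ) - t) ^ 2 / (2 * (s * t))) / 2 = ((s : ℝ) - t) ^ 2 / (2 ^ 2 * (s * t)) by ring,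
      Real.sqrt_div' _ (by positivity), Real.sqrt_sq_eq_abs, Real.sqrt_mul (by positivity),
      Real.sqrt_sq (by norm_num : (0 : ℝ) ≤ 2)]
  rw [hroot]
  rcases lt_trichotomy (t : ℝ) s with h | h | h
  · rw [gaussianMode_meanAccept_of_lt hs ht h]
    have hr0 : 0 < Real.sqrt t / Real.sqrt s := div_pos (Real.sqrt_pos.mpr ht') (Real.sqrt_pos.mpr hs')
    have hr1 : Real.sqrt t / Real.sqrt s < 1 := by
      rw [div_lt_one (Real.sqrt_pos.mpr hs')]; exact Real.sqrt_lt_sqrt ht'.le h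
    rw [four_div_pi_arctan_eq hr0 hr1, gaussMode_sqrtRatio_identity hs' ht', abs_of_pos (by linarith : (0 : ℝ) < s - t)]
  · have hst : s = t := NNReal.coe_injective h.symm
    subst hst
    rw [gaussianMode_meanAccept_self hs, sub_self, abs_zero, zero_div, Real.arctan_zero]; ring
  · rw [gaussianMode_meanAccept_of_gt hs ht h]
    have hr0 : 0 < Real.sqrt s / Real.sqrt t := div_pos (Real.sqrt_pos.mpr hs') (Real.sqrt_pos.mpr ht')
    have hr1 : Real.sqrt s / Real.sqrt t < 1 := by
      rw [div_lt_one (Real.sqrt_pos.mpr ht')]; exact Real.sqrt_lt_sqrt hs'.le h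
    rw [four_div_pi_arctan_eq hr0 hr1, gaussMode_sqrtRatio_identity ht' hs', abs_of_neg (by linarith : (s : ℝ) - t < 0),
      mul_comm (t : ℝ) s, neg_sub]

end GaussianMode

end Summit.Ventures.LatticeQCDFlow.Exactness
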